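import Literature.Analysis.Complex.PlaneDomainKoebeTower
import Literature.Analysis.Complex.Montel
import Literature.Analysis.Complex.RiemannMapping
import Literature.Analysis.Complex.PlaneDomainExtremalMap
import Literature.Analysis.Complex.PlaneDomainCoveringCriterion
import Mathlib.Analysis.Complex.Schwarz
import Mathlib.Analysis.Complex.AbsMax
import Mathlib.Topology.UniformSpace.UniformApproximation
import HarnessLib

/-!
# Uniformization of plane domains, brick N1c (iii): the disc-lifting property of an extremal map

PROOF-ONLY file (no definitions; abc-iut cell, seat abc-iut-w5-d038 gen 6, brick «UNIF-G1P · N1c-TOWER»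
of abc-iut-L4-t8's programme behind the named fact `Complex.PlaneDomainDiscCovering`, GAP row
G-L4t8g7-1).  Y. Fisher, J. H. Hubbard, B. S. Wittner, *A proof of the uniformization theorem for
arbitrary plane domains*, Proc. AMS **104** (1988) 413–418, §3 Part c «proof of convergence»
(Prop. 3.2, Lemmas 3.3–3.4), run on the disc instead of the universal covering `Ũ`.  From the tower
`P_n ∘ G_n = F`, `‖G_n′(0)‖ → 1` of `PlaneDomainKoebeTower.lean`:

* by Montel (tree `Complex.exists_strictMono_tendstoLocallyUniformlyOn_of_norm_le`) and the EQUALITY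
  CASE OF THE SCHWARZ LEMMA (Mathlib `Complex.affine_of_mapsTo_ball_of_norm_dslope_eq_div`) a
  subsequence of `G_n` converges locally uniformly to a ROTATION `z ↦ c z`, `‖c‖ = 1`;
* along a further subsequence `P_n → Q` with `Q(c z) = F z` («`p = π ∘ f`», FHW Lemma 3.4);
* the based lifts `ĝ_n` of a holomorphic test map `g : 𝔻 → U` through `P_n` (`P_n ∘ ĝ_n = g`,
  `ĝ_n 0 = G_n z`) converge along a sub-subsequence to `L : 𝔻 → 𝔻̄` with `L 0 = c z ∈ 𝔻`, hence
  `L(𝔻) ⊆ 𝔻` by the maximum modulus principle (Mathlib `Complex.eqOn_of_isPreconnected_of_isMaxOn_norm`)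
  and `Q ∘ L = g`; so `ĝ := c⁻¹ L` lifts `g` through `F` with `ĝ 0 = z`.

Results: **`Complex.exists_discLift_of_extremal`** — the DISC-LIFTING PROPERTY of an extremal map
`F : 𝔻 → U` (`U ⊆ 𝔻` open, `0 ∈ U`, `F 0 = 0`, `‖F′(0)‖` maximal): every holomorphic `g : 𝔻 → U` with
`g 0 = F z` lifts through `F` to a holomorphic `ĝ : 𝔻 → 𝔻` with `ĝ 0 = z`.  The local holomorphic
SECTIONS of `F` over discs `B ⊆ U` (`Complex.exists_holomorphicSections_of_extremal`, the input of
abc-iut-w5-d089's covering criterion `Complex.surjOn_and_isCoveringMap_of_holomorphicSections`), and the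
resulting **uniformization of the sub-domains of the disc** `Complex.exists_disc_covering_of_subset_ball`
(every connected open `U ⊆ 𝔻` is holomorphically covered by `𝔻`; the general plane domain reduces to
this along the modular function, `PlaneDomainLambdaTransport.lean`).  Classical mathematics; nothing here
touches [IUTchIII] Cor. 3.12.
[cite: FisherHubbardWittner1988, §3 Part c pp.415–417]
-/

noncomputable section

open Set Metric Filter Topology Function

namespace Complex

/-- Subsequences of a locally uniformly convergent sequence converge locally uniformly. [folklore] -/
private theorem tendstoLocallyUniformlyOn_subseq {F : ℕ → ℂ → ℂ} {f : ℂ → ℂ} {s : Set ℂ}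
    (h : TendstoLocallyUniformlyOn F f atTop s) {χ : ℕ → ℕ} (hχ : StrictMono χ) :
    TendstoLocallyUniformlyOn (fun n => F (χ n)) f atTop s := by
  intro u hu x hx
  obtain ⟨t, ht, hev⟩ := h u hu x hx
  exact ⟨t, ht, hχ.tendsto_atTop.eventually hev⟩

/-- If `F n → f` locally uniformly on the open unit disc, `x n → x ∈ 𝔻` with all `x n ∈ 𝔻`, and
`F n (x n) = y` for all `n`, then `f x = y`. [folklore] -/
private theorem eq_of_tendstoLocallyUniformlyOn_ball {F : ℕ → ℂ → ℂ} {f : ℂ → ℂ}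
    (h : TendstoLocallyUniformlyOn F f atTop (ball (0 : ℂ) 1)) (hf : DifferentiableOn ℂ f (ball 0 1))
    {x : ℕ → ℂ} {x₀ y : ℂ} (hx₀ : x₀ ∈ ball (0 : ℂ) 1) (hxm : ∀ n, x n ∈ ball (0 : ℂ) 1)
    (hx : Tendsto x atTop (𝓝 x₀)) (hy : ∀ n, F n (x n) = y) : f x₀ = y := by
  have h1 : Tendsto (fun n => F n (x n)) atTop (𝓝 (f x₀)) :=
    h.tendsto_comp (hf.continuousOn.continuousWithinAt hx₀) hx₀
      (tendsto_nhdsWithin_iff.2 ⟨hx, Eventually.of_forall hxm⟩)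
  have h2 : (fun n => F n (x n)) = fun _ => y := funext hy
  rw [h2] at h1
  exact tendsto_nhds_unique h1 tendsto_const_nhds

/-- **The disc-lifting property of an extremal map** (Fisher–Hubbard–Wittner 1988, §3 Part c,
Prop. 3.2 with Lemmas 3.3–3.4, on the disc).  Let `U ⊆ 𝔻` be open with `0 ∈ U` and let `F` be
holomorphic on `𝔻` with `F(𝔻) ⊆ U`, `F 0 = 0` and `‖F′(0)‖` maximal among holomorphic maps `𝔻 → U`
taking `0` to `0`.  Then every holomorphic `g : 𝔻 → U` lifts through `F`: for each `z ∈ 𝔻` with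
`F z = g 0` there is a holomorphic `ĝ : 𝔻 → 𝔻` with `ĝ 0 = z` and `F ∘ ĝ = g` on `𝔻`.
[cite: FisherHubbardWittner1988, §3 Part c Prop. 3.2 pp.415–417] -/
theorem exists_discLift_of_extremal {U : Set ℂ} (hUo : IsOpen U) (hU : U ⊆ ball (0 : ℂ) 1)
    (h0 : (0 : ℂ) ∈ U) {F : ℂ → ℂ} (hF : DifferentiableOn ℂ F (ball 0 1))
    (hFU : MapsTo F (ball 0 1) U) (hF0 : F 0 = 0)
    (hmax : ∀ g : ℂ → ℂ, DifferentiableOn ℂ g (ball 0 1) → MapsTo g (ball 0 1) U → g 0 = 0 →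
      ‖deriv g 0‖ ≤ ‖deriv F 0‖)
    {g : ℂ → ℂ} (hg : DifferentiableOn ℂ g (ball 0 1)) (hgU : MapsTo g (ball 0 1) U)
    {z : ℂ} (hz : z ∈ ball (0 : ℂ) 1) (hzg : F z = g 0) :
    ∃ gl : ℂ → ℂ, DifferentiableOn ℂ gl (ball 0 1) ∧ MapsTo gl (ball 0 1) (ball 0 1) ∧ gl 0 = z ∧
      ∀ ζ ∈ ball (0 : ℂ) 1, F (gl ζ) = g ζ := by
  classical
  obtain ⟨P, G, hPd, hPm, -, hGd, hGm, hG0, hPG, hlift, hlim⟩ :=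
    exists_koebeTower_of_extremal hUo hU h0 hF hFU hF0 hmax
  have hb0 : (0 : ℂ) ∈ ball (0 : ℂ) 1 := mem_ball_self one_pos
  have hle1 : ∀ (f : ℂ → ℂ), MapsTo f (ball 0 1) (ball 0 1) → ∀ w ∈ ball (0 : ℂ) 1, ‖f w‖ ≤ 1 :=
    fun f hf w hw => (mem_ball_zero_iff.1 (hf hw)).le
  -- Step 1: a subsequence of `G n` converges to a rotation `w ↦ w * c`
  obtain ⟨ρ, φ, hφ, hρd, hGρ, hGρ'⟩ := exists_strictMono_tendstoLocallyUniformlyOn_of_norm_le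
    isOpen_ball (F := G) (M := 1) hGd (fun n w hw => hle1 _ (hGm n) w hw)
  have hρ0 : ρ 0 = 0 := by
    have h1 : Tendsto (fun n => G (φ n) 0) atTop (𝓝 (ρ 0)) := hGρ.tendsto_at hb0
    simp only [hG0] at h1
    exact tendsto_nhds_unique h1 tendsto_const_nhds
  have hρ'1 : ‖deriv ρ 0‖ = 1 := by
    have h1 : Tendsto (fun n => deriv (G (φ n)) 0) atTop (𝓝 (deriv ρ 0)) := hGρ'.tendsto_at hb0
    exact tendsto_nhds_unique h1.norm (hlim.comp hφ.tendsto_atTop)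
  have hρm : MapsTo ρ (ball 0 1) (closedBall 0 1) := fun w hw =>
    isClosed_closedBall.mem_of_tendsto (hGρ.tendsto_at hw)
      (Eventually.of_forall fun n => ball_subset_closedBall (hGm _ hw))
  set c : ℂ := deriv ρ 0 with hc
  have hcn : ‖c‖ = 1 := hρ'1
  have hc0 : c ≠ 0 := norm_ne_zero_iff.1 (by rw [hcn]; exact one_ne_zero)
  have hρeq : ∀ w ∈ ball (0 : ℂ) 1, ρ w = w * c := by
    have h := affine_of_mapsTo_ball_of_norm_dslope_eq_div (R₂ := 1) hρd (by rwa [hρ0]) hb0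
      (by rw [dslope_same, hρ'1, div_one])
    intro w hw
    have := h hw
    simp only [hρ0, zero_add, sub_zero, smul_eq_mul, dslope_same] at this
    exact this
  -- Step 2: along a further subsequence `P n → Q` with `Q (w * c) = F w`
  obtain ⟨Q, ψ, hψ, hQd, hPQ, -⟩ := exists_strictMono_tendstoLocallyUniformlyOn_of_norm_le
    isOpen_ball (F := fun n => P (φ n)) (M := 1) (fun n => hPd _) (fun n w hw => hle1 _ (hPm _) w hw)
  have hGρ2 : TendstoLocallyUniformlyOn (fun n => G (φ (ψ n))) ρ atTop (ball 0 1) :=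
    tendstoLocallyUniformlyOn_subseq hGρ hψ
  have hmulc : ∀ w ∈ ball (0 : ℂ) 1, w * c ∈ ball (0 : ℂ) 1 := fun w hw => by
    rw [mem_ball_zero_iff, norm_mul, hcn, mul_one]
    exact mem_ball_zero_iff.1 hw
  have hQF : ∀ w ∈ ball (0 : ℂ) 1, Q (w * c) = F w := by
    intro w hw
    have hx : Tendsto (fun n => G (φ (ψ n)) w) atTop (𝓝 (w * c)) := by
      rw [← hρeq w hw]
      exact hGρ2.tendsto_at hw
    exact eq_of_tendstoLocallyUniformlyOn_ball hPQ hQd (hmulc w hw) (fun n => hGm _ hw) hx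
      (fun n => hPG _ w hw)
  -- Step 3: the based lifts of `g` through `P (φ (ψ n))` and their limit `L`
  have hex : ∀ n, ∃ gl : ℂ → ℂ, DifferentiableOn ℂ gl (ball 0 1) ∧ MapsTo gl (ball 0 1) (ball 0 1) ∧
      gl 0 = G (φ (ψ n)) z ∧ ∀ ζ ∈ ball (0 : ℂ) 1, P (φ (ψ n)) (gl ζ) = g ζ :=
    fun n => hlift (φ (ψ n)) g hg hgU z hz hzg
  choose gl hgld hglm hgl0 hPgl using hex
  obtain ⟨L, χ, hχ, hLd, hglL, -⟩ := exists_strictMono_tendstoLocallyUniformlyOn_of_norm_le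
    isOpen_ball (F := gl) (M := 1) hgld (fun n w hw => hle1 _ (hglm n) w hw)
  have hL0 : L 0 = z * c := by
    have h1 : Tendsto (fun n => gl (χ n) 0) atTop (𝓝 (L 0)) := hglL.tendsto_at hb0
    have h2 : Tendsto (fun n => G (φ (ψ (χ n))) z) atTop (𝓝 (ρ z)) :=
      (tendstoLocallyUniformlyOn_subseq hGρ2 hχ).tendsto_at hz
    simp only [hgl0] at h1
    rw [← hρeq z hz]
    exact tendsto_nhds_unique h1 h2
  have hLm' : MapsTo L (ball 0 1) (closedBall 0 1) := fun w hw =>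
    isClosed_closedBall.mem_of_tendsto (hglL.tendsto_at hw)
      (Eventually.of_forall fun n => ball_subset_closedBall (hglm _ hw))
  -- `L(𝔻) ⊆ 𝔻` by the maximum modulus principle (`‖L 0‖ = ‖z‖ < 1`)
  have hL0n : ‖L 0‖ < 1 := by
    rw [hL0]; exact mem_ball_zero_iff.1 (hmulc z hz)
  have hLm : MapsTo L (ball 0 1) (ball 0 1) := by
    intro w hw
    by_contra hLw
    have hnorm : ‖L w‖ = 1 :=
      le_antisymm (mem_closedBall_zero_iff.1 (hLm' hw)) (not_lt.1 fun h => hLw (mem_ball_zero_iff.2 h))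
    have hmx : IsMaxOn (norm ∘ L) (ball 0 1) w := fun y hy => by
      simpa only [mem_setOf_eq, comp_apply, hnorm] using mem_closedBall_zero_iff.1 (hLm' hy)
    have heq := eqOn_of_isPreconnected_of_isMaxOn_norm (convex_ball (0 : ℂ) 1).isPreconnected
      isOpen_ball hLd hw hmx
    have : L 0 = L w := heq hb0
    rw [this, hnorm] at hL0n
    exact lt_irrefl _ hL0n
  -- `Q ∘ L = g` on `𝔻`
  have hPQ2 : TendstoLocallyUniformlyOn (fun n => P (φ (ψ (χ n)))) Q atTop (ball 0 1) :=
    tendstoLocallyUniformlyOn_subseq hPQ hχ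
  have hQL : ∀ ζ ∈ ball (0 : ℂ) 1, Q (L ζ) = g ζ := fun ζ hζ =>
    eq_of_tendstoLocallyUniformlyOn_ball hPQ2 hQd (hLm hζ) (fun n => hglm _ hζ) (hglL.tendsto_at hζ)
      (fun n => hPgl (χ n) ζ hζ)
  -- the lift `ĝ = c⁻¹ L`
  refine ⟨fun ζ => L ζ * c⁻¹, hLd.mul_const _, fun ζ hζ => ?_, ?_, fun ζ hζ => ?_⟩
  · rw [mem_ball_zero_iff, norm_mul, norm_inv, hcn, inv_one, mul_one]
    exact mem_ball_zero_iff.1 (hLm hζ)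
  · simp only [hL0, mul_assoc, mul_inv_cancel₀ hc0, mul_one]
  · have h1 : L ζ * c⁻¹ ∈ ball (0 : ℂ) 1 := by
      rw [mem_ball_zero_iff, norm_mul, norm_inv, hcn, inv_one, mul_one]
      exact mem_ball_zero_iff.1 (hLm hζ)
    rw [← hQF _ h1, mul_assoc, inv_mul_cancel₀ hc0, mul_one, hQL ζ hζ]

/-- **Local holomorphic sections of an extremal map over every disc** (the input shape of the
covering criterion of abc-iut-w5-d089, `PlaneDomainCoveringCriterion.lean`).  Let `U ⊆ 𝔻` be open with
`0 ∈ U` and `F` holomorphic on `𝔻`, `F(𝔻) ⊆ U`, `F 0 = 0`, `‖F′(0)‖` maximal among holomorphic maps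
`𝔻 → U` taking `0` to `0`.  Then over every disc `ball c r ⊆ U` and through every `z ∈ 𝔻` with
`F z ∈ ball c r` there is a holomorphic section `σ : ball c r → 𝔻` of `F` with `σ (F z) = z`
(the disc-lifting property `Complex.exists_discLift_of_extremal` applied to the chart
`ζ ↦ c + r·φ_{-p}(ζ)`, `p = (F z - c)/r`, of the disc `ball c r` centred at `F z`).
[cite: FisherHubbardWittner1988, §3 Part c Prop. 3.2 pp.415–417] -/
theorem exists_holomorphicSections_of_extremal {U : Set ℂ} (hUo : IsOpen U) (hU : U ⊆ ball (0 : ℂ) 1)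
    (h0 : (0 : ℂ) ∈ U) {F : ℂ → ℂ} (hF : DifferentiableOn ℂ F (ball 0 1))
    (hFU : MapsTo F (ball 0 1) U) (hF0 : F 0 = 0)
    (hmax : ∀ g : ℂ → ℂ, DifferentiableOn ℂ g (ball 0 1) → MapsTo g (ball 0 1) U → g 0 = 0 →
      ‖deriv g 0‖ ≤ ‖deriv F 0‖) :
    ∀ (c : ℂ) (r : ℝ), ball c r ⊆ U → ∀ z ∈ ball (0 : ℂ) 1, F z ∈ ball c r →
      ∃ σ : ℂ → ℂ, DifferentiableOn ℂ σ (ball c r) ∧ MapsTo σ (ball c r) (ball 0 1) ∧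
        σ (F z) = z ∧ ∀ w ∈ ball c r, F (σ w) = w := by
  intro c r hcr z hz hFz
  have hr : 0 < r := by
    have := mem_ball.1 hFz
    exact lt_of_le_of_lt dist_nonneg this
  have hr0 : (r : ℂ) ≠ 0 := by exact_mod_cast hr.ne'
  -- the point `p = (F z - c)/r ∈ 𝔻` and the chart `A ζ = c + r φ_{-p}(ζ)` of `ball c r` at `F z`
  set p : ℂ := (F z - c) / r with hp
  have hp1 : ‖p‖ < 1 := by
    rw [hp, norm_div, Complex.norm_real, Real.norm_of_nonneg hr.le, div_lt_one hr, ← dist_eq_norm]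
    exact mem_ball.1 hFz
  have hnp1 : ‖-p‖ < 1 := by rwa [norm_neg]
  set A : ℂ → ℂ := fun ζ => c + r * discMobius (-p) ζ with hA
  set Ai : ℂ → ℂ := fun w => discMobius p ((w - c) / r) with hAi
  have hAd : DifferentiableOn ℂ A (ball 0 1) :=
    ((differentiableOn_discMobius hnp1).const_mul (r : ℂ)).const_add c
  have hAm : MapsTo A (ball 0 1) (ball c r) := fun ζ hζ => by
    rw [mem_ball, dist_eq_norm, hA]
    simp only [add_sub_cancel_left, norm_mul, Complex.norm_real, Real.norm_of_nonneg hr.le]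
    have := norm_discMobius_lt_one hnp1 (mem_ball_zero_iff.1 hζ)
    nlinarith
  have hA0 : A 0 = F z := by
    simp only [hA, discMobius_zero, neg_neg, hp]
    field_simp
    ring
  have hquot : ∀ w ∈ ball c r, ‖(w - c) / r‖ < 1 := fun w hw => by
    rw [norm_div, Complex.norm_real, Real.norm_of_nonneg hr.le, div_lt_one hr, ← dist_eq_norm]
    exact mem_ball.1 hw
  have hAim : MapsTo Ai (ball c r) (ball 0 1) := fun w hw =>
    mem_ball_zero_iff.2 (norm_discMobius_lt_one hp1 (hquot w hw))
  have hAid : DifferentiableOn ℂ Ai (ball c r) := by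
    intro w hw
    have h1 : DifferentiableAt ℂ (fun w : ℂ => (w - c) / r) w :=
      (differentiableAt_id.sub_const c).div_const (r : ℂ)
    have h2 : DifferentiableAt ℂ (discMobius p) ((w - c) / r) :=
      differentiableAt_discMobius hp1 (hquot w hw).le
    exact (h2.comp w h1).differentiableWithinAt
  have hAAi : ∀ w ∈ ball c r, A (Ai w) = w := fun w hw => by
    simp only [hA, hAi, discMobius_neg_discMobius hp1 (hquot w hw).le]
    field_simp
    ring
  have hAiFz : Ai (F z) = 0 := by
    simp only [hAi, ← hp, discMobius_self]
  -- the disc-lift of the chart through `F`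
  obtain ⟨gl, hgld, hglm, hgl0, hFgl⟩ := exists_discLift_of_extremal hUo hU h0 hF hFU hF0 hmax hAd
    (fun ζ hζ => hcr (hAm hζ)) hz hA0.symm
  refine ⟨fun w => gl (Ai w), hgld.comp hAid hAim, fun w hw => hglm (hAim hw), ?_, fun w hw => ?_⟩
  · simp only [hAiFz, hgl0]
  · simp only [hFgl _ (hAim hw), hAAi w hw]

/-- **Uniformization of the sub-domains of the disc** (Fisher–Hubbard–Wittner 1988, Theorem p. 413
in the bounded case, cf. the Remark p. 414 «if `U` is bounded to begin with we just need to scale it to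
bring it into the disc»): every connected open `U ⊆ 𝔻` containing `0` is holomorphically covered by
the disc — there is `F` holomorphic on `𝔻` with `F 0 = 0`, mapping `𝔻` ONTO `U`, whose restriction
`𝔻 → U` is a covering map.  ASSEMBLY of brick N1b (`Complex.exists_norm_deriv_max_of_locallyBounded`,
abc-iut-w5-d030: an extremal map exists, the family being bounded by `1`), this file's
`Complex.exists_holomorphicSections_of_extremal`, and abc-iut-w5-d089's covering criterion
`Complex.surjOn_and_isCoveringMap_of_holomorphicSections`.  (The general plane domain omitting two
points reduces to this case along the modular function — `PlaneDomainLambdaTransport.lean`.)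
[cite: FisherHubbardWittner1988, Theorem p.413] -/
theorem exists_disc_covering_of_subset_ball {U : Set ℂ} (hUo : IsOpen U) (hUc : IsPreconnected U)
    (hU : U ⊆ ball (0 : ℂ) 1) (h0 : (0 : ℂ) ∈ U) :
    ∃ F : ℂ → ℂ, DifferentiableOn ℂ F (ball 0 1) ∧ F 0 = 0 ∧
      (∀ g : ℂ → ℂ, DifferentiableOn ℂ g (ball 0 1) → MapsTo g (ball 0 1) U → g 0 = 0 →
        ‖deriv g 0‖ ≤ ‖deriv F 0‖) ∧
      SurjOn F (ball 0 1) U ∧ ∃ h : MapsTo F (ball 0 1) U, IsCoveringMap h.restrict := by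
  obtain ⟨F, hF, hFU, hF0, hmax⟩ := exists_norm_deriv_max_of_locallyBounded (U := U) (a := 0) h0
    (fun c _ => ⟨1, 1, one_pos, fun f _ hfU _ z hz => (mem_ball_zero_iff.1 (hU (hfU hz.2))).le⟩)
  obtain ⟨hsurj, hcov⟩ := surjOn_and_isCoveringMap_of_holomorphicSections hUo hUc hF hFU
    (exists_holomorphicSections_of_extremal hUo hU h0 hF hFU hF0 hmax)
  exact ⟨F, hF, hF0, hmax, hsurj, hFU, hcov⟩

end Complex

end
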